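import Literature.Analysis.Quadrature.GoodLatticePoints

/-!
# Korobov classes `E^k(C)`, the quantity `P^{(k)}(g, m)` and the error of the method of good
# lattice points (Niederreiter 1978, §4: Definition 4.1, Theorem 4.2, inequality (4.6))

Let `𝕋ᵈ = (ℝ/ℤ)ᵈ` with its Haar probability measure, `r(𝐡) = ∏ⱼ max(1, |hⱼ|)` for `𝐡 ∈ ℤᵈ`
(`rWeight`, eq. (4.3) of the source), and let `Q_{m,g}(f) = (1/m) Σ_{n=1}^{m} f((n/m) g)` be the
`m`-point rank-1 lattice rule with lattice point `g ∈ ℤᵈ` (`latticeRule m g` of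
`Literature.Analysis.Quadrature.LatticeRules`, eq. (4.1) of the source) and `L⊥ = {𝐡 : 𝐡 · g ≡ 0
(mod m)}` its dual lattice (`dualLattice m g`).  Following H. Niederreiter, *Quasi-Monte Carlo
methods and pseudo-random numbers*, Bull. Amer. Math. Soc. 84 (1978), §4 "Good lattice points",
pp. 984–986, we formalise, with complete proofs:

* **Definition 4.1** [cite: Niederreiter1978, Def. 4.1]: for real `k > 1` and `C`, the class
  `E^k(C)` of continuous `f : 𝕋ᵈ → ℂ` whose Fourier coefficients satisfy `|f̂(𝐡)| ≤ C r(𝐡)^{-k}` for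
  all `𝐡 ≠ 0` (eq. (4.4)) — `KorobovClass d k C`; the Fourier series of such an `f` is absolutely
  convergent (p. 985, "it is seen easily") — `summable_mFourierCoeff_of_mem_korobovClass`;
* the quantity `P^{(k)}(g, m) = Σ_{0 ≠ 𝐡 ∈ L⊥} r(𝐡)^{-k}` (p. 985; the `P_α(g, N)`, `α = k`, of
  Niederreiter 1992, §5.1) — `pFigure k g m`, a convergent series for `k > 1` (`hasSum_pFigure`);
* **Theorem 4.2** (Korobov 1959 [161], Hlawka 1962 [113]) [cite: Niederreiter1978, Thm. 4.2]: for
  every `f ∈ E^k(C)`, `g ∈ ℤᵈ` and integer `m ≥ 2`, `|Q_{m,g}(f) - ∫_{𝕋ᵈ} f| ≤ C · P^{(k)}(g, m)`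
  (`norm_latticeRule_sub_integral_le_mul_pFigure`, stated for all `m ≥ 1`; it is eq. (4.2) of the
  source, our `norm_latticeRule_sub_integral_le_of_le`, combined with (4.4); Niederreiter 1992,
  Thm. 5.3);
* **inequality (4.6)** [cite: Niederreiter1978, eq. (4.6)] (cf. Niederreiter 1992, Thm. 5.5): for
  any real `k > 1`, `g ∈ ℤᵈ` and integer `m ≥ 2` (here: all `m ≥ 1`),
  `P^{(k)}(g, m) < (1 + 2ζ(k))^d (m^{-k} + R(g, m)^k)`, where
  `R(g, m) = Σ_{0 ≠ 𝐡 ∈ C_d(m) ∩ L⊥} r(𝐡)^{-1}` is the figure of merit of Definition 4.3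
  (`figureOfMerit g m` of `Literature.Analysis.Quadrature.GoodLatticePoints`, with the same residue
  box `C_d(m) = ((-m/2, m/2] ∩ ℤ)ᵈ`) and `ζ(k) = Σ_{n ≥ 1} n^{-k}` (`zetaReal k`; `ofReal_zetaReal`
  identifies it with Mathlib's `riemannZeta k`) — `pFigure_lt`.  The source states (4.6) for
  `m ≥ 2` and proves it by reference ("by using the method in [174, pp. 156–157]", i.e.
  Kuipers–Niederreiter, *Uniform Distribution of Sequences*, 1974); the proof given here is the
  standard one: write `𝐡 = 𝐡₀ + m 𝐪` with `𝐡₀ ∈ C_d(m)` (`cRem`, `cQuot`), use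
  `r(𝐡₀ + m 𝐪) ≥ r(𝐡₀) r(𝐪)` for `𝐡₀ ∈ C_d(m)`, `r(m 𝐪) ≥ m r(𝐪)` for `𝐪 ≠ 0`,
  `Σ_{𝐪 ∈ ℤᵈ} r(𝐪)^{-k} = (1 + 2ζ(k))^d` and `Σᵢ aᵢ^k ≤ (Σᵢ aᵢ)^k`, which yields the slightly
  sharper `P^{(k)}(g, m) ≤ (1 + 2ζ(k))^d (m^{-k} + Σ_{0 ≠ 𝐡 ∈ C_d(m) ∩ L⊥} r(𝐡)^{-k}) - m^{-k}`
  (`pFigure_le`);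
* the conclusion drawn on p. 986 ("by combining the above results, we obtain that for a good
  lattice point `g` modulo `m` the integration error in (4.1) is of the order of magnitude
  `O(m^{-k} (log m)^{ks})` for integrands `f ∈ E^k`") in the explicit form available from this
  library: combining Theorem 4.2 and (4.6) with the existence of good lattice points of Korobov
  form for PRIME moduli, `R((1, g, …, g^{s-1}), N) < ((s-1)/N)(2 log N + 1)^s`
  (`exists_korobovPoint_figureOfMerit_lt` = Niederreiter 1992, Thm. 5.18, in place of the source's
  Theorem 4.4 for general `m`), for every prime `N`, `s ≥ 2` and `k > 1` there is a Korobov-form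
  lattice point `g` with
  `|Q_{N,g}(f) - ∫ f| ≤ C (1 + 2ζ(k))^s (N^{-k} + (((s-1)/N)(2 log N + 1)^s)^k)`
  for all `f ∈ E^k_s(C)` simultaneously (`exists_korobovPoint_norm_latticeRule_sub_integral_le`)
  [cite: Niederreiter1978, p. 986].

Design: as in `LatticeRules`, the measure on `ℝ/ℤ` is normalised to mass `1` by re-activating that
file's three local instances, so that `volume` on `𝕋ᵈ` is the one used by
`UnitAddTorus.mFourierCoeff`; `k` is a real exponent (`Real.rpow`), and `r(𝐡)^{-k}` is written
`(rWeight 𝐡 ^ k)⁻¹`.  Deliberately NOT here: Zaremba's sufficient condition for membership in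
`E^k(C)` via partial derivatives of bounded variation (p. 985), Theorem 4.4 (good lattice points for
composite `m`), and the quantity `ρ(g, m)` with Theorems 4.5–4.6.

## References

* H. Niederreiter, *Quasi-Monte Carlo methods and pseudo-random numbers*, Bull. Amer. Math. Soc.
  84 (1978), no. 6, 957–1041: §4, eqs. (4.1)–(4.6), Definition 4.1, Theorem 4.2, Definition 4.3 and
  the remark on p. 986. [cite: Niederreiter1978, §4]
* H. Niederreiter, *Random Number Generation and Quasi-Monte Carlo Methods*, CBMS-NSF 63, SIAM
  1992, §5.1 (the same material as Def. 5.1–Thm. 5.5; cf. `LatticeRules`, `GoodLatticePoints`).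
  [cite: Niederreiter1992, §5.1]
* Primary sources as attributed by Niederreiter (not consulted directly for this file):
  N. M. Korobov, Dokl. Akad. Nauk SSSR 124 (1959) 1207–1210 (ref. [161]); E. Hlawka, Monatsh. Math.
  66 (1962) 140–151 (ref. [113]); L. Kuipers, H. Niederreiter, *Uniform Distribution of
  Sequences*, Wiley 1974, pp. 156–157 (ref. [174]).

AI-produced formalisation (H21 engines group, seat eng-quad-1, 2026-08-20); no facts, no axioms
beyond Mathlib's, no `sorry`.
-/

open scoped Real
open MeasureTheory Finset Filter UnitAddTorus

noncomputable section

namespace Literature.Analysis.Quadrature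

attribute [local instance] latticeRules_measureSpace latticeRules_isAddHaarMeasure
  latticeRules_isProbabilityMeasure

variable {d : Type*} [Fintype d] [DecidableEq d]

/-! ### `ζ(k)` for real `k > 1` and `Σ_{q ∈ ℤ} max(1, |q|)^{-k} = 1 + 2ζ(k)` -/

/-- `ζ(k) = Σ_{n ≥ 1} n^{-k}` as a real number (the term `n = 0` of the `tsum` vanishes for
`k ≠ 0` by Mathlib's conventions `0 ^ k = 0`, `0⁻¹ = 0`). [cite: Niederreiter1978, eq. (4.6)] -/
def zetaReal (k : ℝ) : ℝ :=
  ∑' n : ℕ, ((n : ℝ) ^ k)⁻¹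

/-- `ζ(k) ≥ 0`. [folklore] -/
private theorem zetaReal_nonneg (k : ℝ) : 0 ≤ zetaReal k :=
  tsum_nonneg fun n => inv_nonneg.mpr (Real.rpow_nonneg (Nat.cast_nonneg n) k)

/-- For real `k > 1`, `zetaReal k` is the value `ζ(k)` of the Riemann zeta-function (Mathlib's
`riemannZeta`): the `ζ` of inequality (4.6) "where `ζ` is the Riemann zeta-function" (p. 985).
[cite: Niederreiter1978, eq. (4.6)] -/
theorem ofReal_zetaReal {k : ℝ} (hk : 1 < k) : ((zetaReal k : ℝ) : ℂ) = riemannZeta k := by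
  rw [zeta_eq_tsum_one_div_nat_cpow (by simpa using hk), zetaReal, Complex.ofReal_tsum]
  refine tsum_congr fun n => ?_
  rw [Complex.ofReal_inv, Complex.ofReal_cpow (Nat.cast_nonneg n), one_div]
  norm_cast

/-- `Σ_{n ≥ 0} (n + 1)^{-k} = ζ(k)` for `k > 1`. [folklore] -/
private theorem hasSum_nat_add_one_rpow_inv {k : ℝ} (hk : 1 < k) :
    HasSum (fun n : ℕ => (((n : ℝ) + 1) ^ k)⁻¹) (zetaReal k) := by
  have hk0 : k ≠ 0 := by linarith
  have hs : Summable fun n : ℕ => ((n : ℝ) ^ k)⁻¹ := Real.summable_nat_rpow_inv.mpr hk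
  have h := (hasSum_nat_add_iff' (f := fun n : ℕ => ((n : ℝ) ^ k)⁻¹) 1).mpr hs.hasSum
  simp only [Finset.sum_range_one, Nat.cast_zero, Real.zero_rpow hk0, inv_zero, sub_zero,
    Nat.cast_add, Nat.cast_one] at h
  exact h

/-- `Σ_{q ∈ ℤ} max(1, |q|)^{-k} = 1 + 2ζ(k)` for real `k > 1` (the one-dimensional factor of the
constant in (4.6)). [cite: Niederreiter1978, eq. (4.6)] -/
theorem hasSum_int_max_one_abs_rpow_inv {k : ℝ} (hk : 1 < k) :
    HasSum (fun q : ℤ => ((max 1 |(q : ℝ)|) ^ k)⁻¹) (1 + 2 * zetaReal k) := by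
  have h1 := hasSum_nat_add_one_rpow_inv hk
  have e1 : ∀ n : ℕ, ((max 1 |(((n + 1 : ℕ) : ℤ) : ℝ)|) ^ k)⁻¹ = (((n : ℝ) + 1) ^ k)⁻¹ := by
    intro n
    have hn : (1 : ℝ) ≤ (n : ℝ) + 1 := by
      have := (Nat.cast_nonneg n : (0 : ℝ) ≤ n)
      linarith
    rw [Int.cast_natCast, Nat.cast_add, Nat.cast_one, abs_of_nonneg (by positivity),
      max_eq_right hn]
  have e2 : ∀ n : ℕ, ((max 1 |((-((n : ℤ) + 1) : ℤ) : ℝ)|) ^ k)⁻¹ = (((n : ℝ) + 1) ^ k)⁻¹ := by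
    intro n
    have hn : (1 : ℝ) ≤ (n : ℝ) + 1 := by
      have := (Nat.cast_nonneg n : (0 : ℝ) ≤ n)
      linarith
    rw [Int.cast_neg, Int.cast_add, Int.cast_natCast, Int.cast_one, abs_neg,
      abs_of_nonneg (by positivity), max_eq_right hn]
  -- the half `q ≥ 0`
  have hpos : HasSum (fun n : ℕ => ((max 1 |((n : ℤ) : ℝ)|) ^ k)⁻¹) (1 + zetaReal k) := by
    have h := (hasSum_nat_add_iff (f := fun n : ℕ => ((max 1 |((n : ℤ) : ℝ)|) ^ k)⁻¹) 1).mp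
      (h1.congr_fun e1)
    simp only [Finset.sum_range_one, Nat.cast_zero, Int.cast_zero, abs_zero,
      max_eq_left (zero_le_one : (0 : ℝ) ≤ 1), Real.one_rpow, inv_one] at h
    rw [add_comm] at h
    exact h
  -- the half `q ≤ -1`
  have hneg : HasSum (fun n : ℕ => ((max 1 |((-((n : ℤ) + 1) : ℤ) : ℝ)|) ^ k)⁻¹) (zetaReal k) :=
    h1.congr_fun e2
  have H := HasSum.of_nat_of_neg_add_one (f := fun q : ℤ => ((max 1 |(q : ℝ)|) ^ k)⁻¹) hpos hneg
  convert H using 1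
  ring

/-! ### Sums of products over `ℤᵈ`; `Σ_{𝐡 ∈ ℤᵈ} r(𝐡)^{-k} ≤ (1 + 2ζ(k))^d` -/

omit [DecidableEq d] in
/-- For nonnegative summable `φᵢ : ℤ → ℝ`, every finite partial sum of `Σ_{𝐪 ∈ ℤᵈ} ∏ᵢ φᵢ(qᵢ)` is at
most `∏ᵢ Σ_{n ∈ ℤ} φᵢ(n)`. [folklore] -/
private theorem sum_prod_le_prod_tsum {φ : d → ℤ → ℝ} (h0 : ∀ i n, 0 ≤ φ i n)
    (hs : ∀ i, Summable (φ i)) (Q : Finset (d → ℤ)) :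
    ∑ q ∈ Q, ∏ i, φ i (q i) ≤ ∏ i, ∑' n, φ i n := by
  classical
  let T : Finset ℤ := Q.biUnion fun q => Finset.univ.image q
  have hQ : Q ⊆ Fintype.piFinset fun _ : d => T := by
    intro q hq
    rw [Fintype.mem_piFinset]
    intro i
    exact Finset.mem_biUnion.mpr ⟨q, hq, Finset.mem_image.mpr ⟨i, Finset.mem_univ _, rfl⟩⟩
  calc ∑ q ∈ Q, ∏ i, φ i (q i)
      ≤ ∑ q ∈ Fintype.piFinset (fun _ : d => T), ∏ i, φ i (q i) :=
        Finset.sum_le_sum_of_subset_of_nonneg hQ fun q _ _ =>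
          Finset.prod_nonneg fun i _ => h0 i (q i)
    _ = ∏ i, ∑ n ∈ T, φ i n := (Finset.prod_univ_sum (fun _ : d => T) φ).symm
    _ ≤ ∏ i, ∑' n, φ i n := by
        refine Finset.prod_le_prod (fun i _ => Finset.sum_nonneg fun n _ => h0 i n) fun i _ => ?_
        exact (hs i).sum_le_tsum T fun n _ => h0 i n

omit [DecidableEq d] in
/-- `r(𝐡)^{-k} = ∏ⱼ max(1, |hⱼ|)^{-k}`. [cite: Niederreiter1978, eq. (4.3)] -/
theorem rWeight_rpow_inv_eq_prod (h : d → ℤ) (k : ℝ) :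
    (rWeight h ^ k)⁻¹ = ∏ j, ((max 1 |(h j : ℝ)|) ^ k)⁻¹ := by
  rw [rWeight, ← Real.finsetProd_rpow Finset.univ (fun j => max 1 |(h j : ℝ)|)
    (fun j _ => by positivity) k, Finset.prod_inv_distrib]

omit [DecidableEq d] in
/-- `r(𝐡)^{-k} ≥ 0`. [folklore] -/
private theorem rWeight_rpow_inv_nonneg (h : d → ℤ) (k : ℝ) : 0 ≤ (rWeight h ^ k)⁻¹ :=
  inv_nonneg.mpr (Real.rpow_nonneg (rWeight_pos h).le k)

omit [DecidableEq d] in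
/-- `r(0)^{-k} = 1`. [folklore] -/
private theorem rWeight_zero : rWeight (0 : d → ℤ) = 1 := by
  simp [rWeight]

omit [DecidableEq d] in
/-- Every finite partial sum of `Σ_{𝐡 ∈ ℤᵈ} r(𝐡)^{-k}` is at most `(1 + 2ζ(k))^d` (`k > 1`).
[cite: Niederreiter1978, eq. (4.6)] -/
theorem sum_rWeight_rpow_inv_le {k : ℝ} (hk : 1 < k) (Q : Finset (d → ℤ)) :
    ∑ h ∈ Q, (rWeight h ^ k)⁻¹ ≤ (1 + 2 * zetaReal k) ^ Fintype.card d := by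
  simp_rw [rWeight_rpow_inv_eq_prod]
  refine (sum_prod_le_prod_tsum (φ := fun (_ : d) (n : ℤ) => ((max 1 |(n : ℝ)|) ^ k)⁻¹)
    (fun _ n => by positivity) (fun _ => (hasSum_int_max_one_abs_rpow_inv hk).summable) Q).trans_eq
    ?_
  show ∏ _i : d, ∑' n : ℤ, ((max 1 |(n : ℝ)|) ^ k)⁻¹ = _
  rw [(hasSum_int_max_one_abs_rpow_inv hk).tsum_eq, Finset.prod_const, Finset.card_univ]

omit [DecidableEq d] in
/-- `Σ_{𝐡 ∈ ℤᵈ} r(𝐡)^{-k}` converges for `k > 1`. [cite: Niederreiter1978, p. 985] -/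
theorem summable_rWeight_rpow_inv {k : ℝ} (hk : 1 < k) :
    Summable fun h : d → ℤ => (rWeight h ^ k)⁻¹ :=
  summable_of_sum_le (fun h => rWeight_rpow_inv_nonneg h k) (sum_rWeight_rpow_inv_le hk)

omit [DecidableEq d] in
/-- `Σ_{𝐡 ∈ ℤᵈ} r(𝐡)^{-k} ≤ (1 + 2ζ(k))^d` for `k > 1` (in fact equality holds).
[cite: Niederreiter1978, eq. (4.6)] -/
theorem tsum_rWeight_rpow_inv_le {k : ℝ} (hk : 1 < k) :
    ∑' h : d → ℤ, (rWeight h ^ k)⁻¹ ≤ (1 + 2 * zetaReal k) ^ Fintype.card d :=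
  Real.tsum_le_of_sum_le (fun h => rWeight_rpow_inv_nonneg h k) (sum_rWeight_rpow_inv_le hk)

/-- Superadditivity of `t ↦ t^p` (`p ≥ 1`) on nonnegative reals: `Σᵢ aᵢ^p ≤ (Σᵢ aᵢ)^p`.
[folklore] -/
private theorem sum_rpow_le_rpow_sum {ι : Type*} (s : Finset ι) {a : ι → ℝ} (ha : ∀ i, 0 ≤ a i)
    {p : ℝ} (hp : 1 ≤ p) : ∑ i ∈ s, a i ^ p ≤ (∑ i ∈ s, a i) ^ p := by
  classical
  induction s using Finset.induction_on with
  | empty => simp [Real.zero_rpow (show p ≠ 0 by linarith)]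
  | insert i s hi ih =>
    rw [Finset.sum_insert hi, Finset.sum_insert hi]
    calc a i ^ p + ∑ j ∈ s, a j ^ p
        ≤ a i ^ p + (∑ j ∈ s, a j) ^ p := by linarith [ih]
      _ ≤ (a i + ∑ j ∈ s, a j) ^ p :=
        Real.add_rpow_le_rpow_add (ha i) (Finset.sum_nonneg fun j _ => ha j) hp

/-! ### Definition 4.1: the classes `E^k(C)` -/

/-- **Niederreiter's regularity class `E^k(C)`** [cite: Niederreiter1978, Def. 4.1] (eq. (4.4);
the `E^s_α(C)` of Korobov): the continuous `f : 𝕋ᵈ → ℂ` with `|f̂(𝐡)| ≤ C · r(𝐡)^{-k}` for all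
lattice points `𝐡 ≠ 0`. -/
def KorobovClass (d : Type*) [Fintype d] (k C : ℝ) : Set C(UnitAddTorus d, ℂ) :=
  {f | ∀ h : d → ℤ, h ≠ 0 → ‖mFourierCoeff f h‖ ≤ C * (rWeight h ^ k)⁻¹}

omit [DecidableEq d] in
/-- Unfolding of membership in `E^k(C)`. [cite: Niederreiter1978, Def. 4.1] -/
theorem mem_korobovClass {k C : ℝ} {f : C(UnitAddTorus d, ℂ)} :
    f ∈ KorobovClass d k C ↔ ∀ h : d → ℤ, h ≠ 0 → ‖mFourierCoeff f h‖ ≤ C * (rWeight h ^ k)⁻¹ :=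
  Iff.rfl

/-- In positive dimension the class `E^k(C)` is empty unless `C ≥ 0` (the source assumes `C > 0`).
[cite: Niederreiter1978, Def. 4.1] -/
theorem KorobovClass.nonneg [Nonempty d] {k C : ℝ} {f : C(UnitAddTorus d, ℂ)}
    (hf : f ∈ KorobovClass d k C) : 0 ≤ C := by
  obtain ⟨i⟩ := ‹Nonempty d›
  have h0 : (Pi.single i 1 : d → ℤ) ≠ 0 := by
    intro h
    simpa using congr_fun h i
  have h1 := mem_korobovClass.mp hf _ h0
  have hw : 0 < (rWeight (Pi.single i 1 : d → ℤ) ^ k)⁻¹ :=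
    inv_pos.mpr (Real.rpow_pos_of_pos (rWeight_pos _) k)
  nlinarith [norm_nonneg (mFourierCoeff f (Pi.single i 1 : d → ℤ))]

omit [DecidableEq d] in
/-- The Fourier series of an `f ∈ E^k(C)` (`k > 1`) is absolutely convergent ("it is seen easily
that its Fourier series is automatically absolutely convergent").
[cite: Niederreiter1978, p. 985] -/
theorem summable_mFourierCoeff_of_mem_korobovClass {k C : ℝ} (hk : 1 < k)
    {f : C(UnitAddTorus d, ℂ)} (hf : f ∈ KorobovClass d k C) : Summable (mFourierCoeff f) := by
  refine Summable.of_norm_bounded_eventually ((summable_rWeight_rpow_inv hk).mul_left C) ?_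
  filter_upwards [eventually_cofinite_ne (0 : d → ℤ)] with h hh using mem_korobovClass.mp hf h hh

/-! ### `P^{(k)}(g, m)` and Theorem 4.2 -/

/-- `P^{(k)}(g, m) = Σ r(𝐡)^{-k}`, the sum over all `𝐡 ≠ 0` with `𝐡 · g ≡ 0 (mod m)`, i.e. over the
nonzero points of the dual lattice `L⊥` (Niederreiter 1992 writes `P_α(g, N)`, `α = k`).
[cite: Niederreiter1978, Thm. 4.2] -/
def pFigure (k : ℝ) (g : d → ℤ) (m : ℕ) : ℝ :=
  ∑' h : ((dualLattice m g : Set (d → ℤ)) \ {0} : Set (d → ℤ)), (rWeight (h : d → ℤ) ^ k)⁻¹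

omit [DecidableEq d] in
/-- For `k > 1` the series `P^{(k)}(g, m)` converges (to `pFigure k g m`).
[cite: Niederreiter1978, Thm. 4.2] -/
theorem hasSum_pFigure {k : ℝ} (hk : 1 < k) (g : d → ℤ) (m : ℕ) :
    HasSum (fun h : ((dualLattice m g : Set (d → ℤ)) \ {0} : Set (d → ℤ)) =>
      (rWeight (h : d → ℤ) ^ k)⁻¹) (pFigure k g m) :=
  ((summable_rWeight_rpow_inv hk).subtype _).hasSum

omit [DecidableEq d] in
/-- `P^{(k)}(g, m) ≥ 0`. [cite: Niederreiter1978, Thm. 4.2] -/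
theorem pFigure_nonneg (k : ℝ) (g : d → ℤ) (m : ℕ) : 0 ≤ pFigure k g m :=
  tsum_nonneg fun h => rWeight_rpow_inv_nonneg (h : d → ℤ) k

omit [DecidableEq d] in
/-- **Theorem 4.2** (Korobov [161], Hlawka [113]) [cite: Niederreiter1978, Thm. 4.2]: for every
`f ∈ E^k(C)` (`k > 1`), every lattice point `g ∈ ℤᵈ` and every integer `m ≥ 2`,
`|(1/m) Σ_{n=1}^{m} f((n/m) g) - ∫_{𝕋ᵈ} f| ≤ C · P^{(k)}(g, m)`.  (The statement and proof are
unchanged for `m = 1`, so we only assume `m ≠ 0`.) -/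
theorem norm_latticeRule_sub_integral_le_mul_pFigure (m : ℕ) [NeZero m] (g : d → ℤ) {k C : ℝ}
    (hk : 1 < k) {f : C(UnitAddTorus d, ℂ)} (hf : f ∈ KorobovClass d k C) :
    ‖latticeRule m g f - ∫ x, f x‖ ≤ C * pFigure k g m :=
  norm_latticeRule_sub_integral_le_of_le m g (summable_mFourierCoeff_of_mem_korobovClass hk hf)
    (fun h h0 _ => mem_korobovClass.mp hf h h0) ((hasSum_pFigure hk g m).mul_left C)

/-! ### The reduction `𝐡 = 𝐡₀ + m 𝐪`, `𝐡₀ ∈ C_d(m)` -/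

/-- The representative of `x` modulo `m` in `C(m) = (-m/2, m/2] ∩ ℤ` (for `m ≥ 1`). [folklore] -/
def cRem (m : ℕ) (x : ℤ) : ℤ :=
  if 2 * (x % (m : ℤ)) ≤ m then x % (m : ℤ) else x % (m : ℤ) - m

/-- The corresponding quotient: `x = cRem m x + m · cQuot m x`. [folklore] -/
def cQuot (m : ℕ) (x : ℤ) : ℤ :=
  if 2 * (x % (m : ℤ)) ≤ m then x / (m : ℤ) else x / (m : ℤ) + 1

/-- `cRem m x + m · cQuot m x = x`. [folklore] -/
private theorem cRem_add_mul_cQuot (m : ℕ) (x : ℤ) : cRem m x + m * cQuot m x = x := by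
  unfold cRem cQuot
  split_ifs <;> linear_combination Int.emod_add_mul_ediv x m

/-- `cRem m x ∈ C(m)` for `m ≥ 1`. [folklore] -/
private theorem cRem_mem_centeredResidues {m : ℕ} (hm : 0 < m) (x : ℤ) :
    cRem m x ∈ centeredResidues m := by
  have h0 : 0 ≤ x % (m : ℤ) := Int.emod_nonneg x (by exact_mod_cast hm.ne')
  have h1 : x % (m : ℤ) < m := Int.emod_lt_of_pos x (by exact_mod_cast hm)
  rw [mem_centeredResidues, cRem]
  generalize x % (m : ℤ) = r at h0 h1 ⊢
  split_ifs with h <;> omega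

omit [Fintype d] [DecidableEq d] in
/-- Coordinatewise `cRem`: the representative `𝐡₀ ∈ C_d(m)` of `𝐡` modulo `m ℤᵈ`. [folklore] -/
def cRemV (m : ℕ) (h : d → ℤ) : d → ℤ := fun j => cRem m (h j)

omit [Fintype d] [DecidableEq d] in
/-- Coordinatewise `cQuot`: `𝐡 = cRemV m 𝐡 + m · cQuotV m 𝐡`. [folklore] -/
def cQuotV (m : ℕ) (h : d → ℤ) : d → ℤ := fun j => cQuot m (h j)

omit [Fintype d] [DecidableEq d] in
/-- `hⱼ = (cRemV m 𝐡)ⱼ + m (cQuotV m 𝐡)ⱼ`. [folklore] -/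
private theorem cRemV_add_mul_cQuotV (m : ℕ) (h : d → ℤ) (j : d) :
    cRemV m h j + m * cQuotV m h j = h j :=
  cRem_add_mul_cQuot m (h j)

/-- `cRemV m 𝐡 ∈ C_d(m)` for `m ≥ 1`. [folklore] -/
private theorem cRemV_mem_centeredBox {m : ℕ} (hm : 0 < m) (h : d → ℤ) :
    cRemV m h ∈ centeredBox d m :=
  mem_centeredBox.mpr fun j => cRem_mem_centeredResidues hm (h j)

omit [DecidableEq d] in
/-- The dual lattice contains `m ℤᵈ`, so it is stable under `𝐡 ↦ 𝐡₀ = cRemV m 𝐡`. [folklore] -/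
private theorem cRemV_mem_dualLattice {m : ℕ} {g h : d → ℤ} (hh : h ∈ dualLattice m g) :
    cRemV m h ∈ dualLattice m g := by
  rw [mem_dualLattice] at hh ⊢
  have e : ∑ j, cRemV m h j * g j = ∑ j, h j * g j - m * ∑ j, cQuotV m h j * g j := by
    rw [Finset.mul_sum, ← Finset.sum_sub_distrib]
    refine Finset.sum_congr rfl fun j _ => ?_
    linear_combination (g j) * cRemV_add_mul_cQuotV m h j
  rw [e]
  exact dvd_sub hh (dvd_mul_right _ _)

/-- One coordinate of `r(𝐡₀) r(𝐪) ≤ r(𝐡₀ + m 𝐪)`: for `a ∈ C(m)` and any integer `b`,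
`max(1,|a|) · max(1,|b|) ≤ max(1, |a + m b|)`. [folklore] -/
private theorem max_one_abs_mul_max_one_abs_le {m : ℕ} {a : ℤ} (ha : a ∈ centeredResidues m)
    (b : ℤ) :
    max 1 |a| * max 1 |b| ≤ max 1 |a + m * b| := by
  rw [mem_centeredResidues] at ha
  obtain ⟨ha1, ha2⟩ := ha
  have h2a : 2 * |a| ≤ (m : ℤ) := by
    rcases abs_cases a with ⟨h, _⟩ | ⟨h, _⟩ <;> omega
  have hmb : |(m : ℤ) * b| = m * |b| := by rw [abs_mul, Nat.abs_cast]
  rcases eq_or_ne b 0 with rfl | hb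
  · simp
  have hb1 : 1 ≤ |b| := Int.one_le_abs hb
  -- `|a + m b| ≥ m |b| - |a|`
  have key : (m : ℤ) * |b| - |a| ≤ |a + m * b| := by
    have := abs_sub_abs_le_abs_sub ((m : ℤ) * b) (-a)
    rw [abs_neg, sub_neg_eq_add, add_comm ((m : ℤ) * b) a, hmb] at this
    exact this
  rcases eq_or_ne a 0 with rfl | ha0
  · rw [abs_zero, max_eq_left (zero_le_one : (0 : ℤ) ≤ 1), one_mul, zero_add, hmb]
    refine max_le_max le_rfl ?_
    have hm1 : (1 : ℤ) ≤ m := by omega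
    nlinarith [abs_nonneg b]
  · have ha1' : 1 ≤ |a| := Int.one_le_abs ha0
    rw [max_eq_right ha1', max_eq_right hb1]
    refine le_trans ?_ (le_max_right _ _)
    nlinarith [key, mul_nonneg (sub_nonneg.2 h2a) (abs_nonneg b),
      mul_nonneg (abs_nonneg a) (sub_nonneg.2 hb1)]

/-- `r(𝐡₀) · r(𝐪) ≤ r(𝐡)` whenever `𝐡 = 𝐡₀ + m 𝐪` with `𝐡₀ ∈ C_d(m)`. [folklore] -/
private theorem rWeight_mul_rWeight_le {m : ℕ} {h₀ q h : d → ℤ} (hh₀ : h₀ ∈ centeredBox d m)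
    (hdec : ∀ j, h j = h₀ j + m * q j) : rWeight h₀ * rWeight q ≤ rWeight h := by
  rw [rWeight, rWeight, rWeight, ← Finset.prod_mul_distrib]
  refine Finset.prod_le_prod (fun j _ => by positivity) fun j _ => ?_
  rw [hdec j]
  exact_mod_cast max_one_abs_mul_max_one_abs_le (mem_centeredBox.mp hh₀ j) (q j)

omit [DecidableEq d] in
/-- `m · r(𝐪) ≤ r(m 𝐪)` for `𝐪 ≠ 0` and `m ≥ 1`. [folklore] -/
private theorem natCast_mul_rWeight_le {m : ℕ} (hm : 0 < m) {q h : d → ℤ} (hq : q ≠ 0)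
    (hdec : ∀ j, h j = m * q j) : (m : ℝ) * rWeight q ≤ rWeight h := by
  classical
  obtain ⟨j₀, hj₀⟩ := Function.ne_iff.mp hq
  have hj₀' : q j₀ ≠ 0 := by simpa using hj₀
  have hm1 : (1 : ℝ) ≤ m := by exact_mod_cast hm
  have hterm : ∀ j, max 1 |(q j : ℝ)| ≤ max 1 |(h j : ℝ)| := fun j => by
    rw [hdec j, Int.cast_mul, Int.cast_natCast, abs_mul, Nat.abs_cast]
    exact max_le_max le_rfl (le_mul_of_one_le_left (abs_nonneg _) hm1)
  have hj : (m : ℝ) * max 1 |(q j₀ : ℝ)| ≤ max 1 |(h j₀ : ℝ)| := by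
    have h1 : (1 : ℝ) ≤ |(q j₀ : ℝ)| := by exact_mod_cast Int.one_le_abs hj₀'
    rw [max_eq_right h1, hdec j₀, Int.cast_mul, Int.cast_natCast, abs_mul, Nat.abs_cast]
    exact le_max_right _ _
  rw [rWeight, rWeight,
    ← Finset.mul_prod_erase Finset.univ (fun j => max 1 |(q j : ℝ)|) (Finset.mem_univ j₀),
    ← Finset.mul_prod_erase Finset.univ (fun j => max 1 |(h j : ℝ)|) (Finset.mem_univ j₀),
    ← mul_assoc]
  exact mul_le_mul hj (Finset.prod_le_prod (fun j _ => by positivity) fun j _ => hterm j)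
    (Finset.prod_nonneg fun j _ => by positivity) (by positivity)

/-! ### Inequality (4.6) -/

/-- The fibre of the reduction map `𝐡 ↦ 𝐡₀` over `𝐡₀ ∈ C_d(m)`: for every finite set `t` of
lattice points with `cRemV m 𝐡 = 𝐡₀`, `Σ_{𝐡 ∈ t} r(𝐡)^{-k} ≤ (1 + 2ζ(k))^d · r(𝐡₀)^{-k}`
(`k > 1`). [cite: Niederreiter1978, eq. (4.6)] -/
theorem sum_rWeight_rpow_inv_le_of_cRemV_eq {k : ℝ} (hk : 1 < k) (m : ℕ) {h₀ : d → ℤ}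
    (hh₀ : h₀ ∈ centeredBox d m) (t : Finset (d → ℤ)) (ht : ∀ h ∈ t, cRemV m h = h₀) :
    ∑ h ∈ t, (rWeight h ^ k)⁻¹ ≤
      (1 + 2 * zetaReal k) ^ Fintype.card d * (rWeight h₀ ^ k)⁻¹ := by
  classical
  have hk0 : 0 ≤ k := by linarith
  have hdec : ∀ h ∈ t, ∀ j, h j = h₀ j + m * cQuotV m h j := fun h hh j => by
    rw [← congr_fun (ht h hh) j]
    exact (cRemV_add_mul_cQuotV m h j).symm
  have hle : ∀ h ∈ t, (rWeight h ^ k)⁻¹ ≤ (rWeight h₀ ^ k)⁻¹ * (rWeight (cQuotV m h) ^ k)⁻¹ :=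
    fun h hh => by
    rw [← mul_inv, ← Real.mul_rpow (rWeight_pos _).le (rWeight_pos _).le]
    exact inv_anti₀ (Real.rpow_pos_of_pos (mul_pos (rWeight_pos _) (rWeight_pos _)) k)
      (Real.rpow_le_rpow (mul_pos (rWeight_pos _) (rWeight_pos _)).le
        (rWeight_mul_rWeight_le hh₀ (hdec h hh)) hk0)
  have hinj : Set.InjOn (cQuotV m) (t : Set (d → ℤ)) := by
    intro h hh h' hh' e
    funext j
    rw [hdec h hh j, hdec h' hh' j, e]
  calc ∑ h ∈ t, (rWeight h ^ k)⁻¹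
      ≤ ∑ h ∈ t, (rWeight h₀ ^ k)⁻¹ * (rWeight (cQuotV m h) ^ k)⁻¹ := Finset.sum_le_sum hle
    _ = (rWeight h₀ ^ k)⁻¹ * ∑ q ∈ t.image (cQuotV m), (rWeight q ^ k)⁻¹ := by
        rw [Finset.mul_sum, Finset.sum_image hinj]
    _ ≤ (rWeight h₀ ^ k)⁻¹ * (1 + 2 * zetaReal k) ^ Fintype.card d :=
        mul_le_mul_of_nonneg_left (sum_rWeight_rpow_inv_le hk _) (rWeight_rpow_inv_nonneg h₀ k)
    _ = (1 + 2 * zetaReal k) ^ Fintype.card d * (rWeight h₀ ^ k)⁻¹ := mul_comm _ _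

omit [DecidableEq d] in
/-- The fibre over `𝐡₀ = 0`: for every finite set `t` of NONZERO lattice points `𝐡 ∈ m ℤᵈ`,
`Σ_{𝐡 ∈ t} r(𝐡)^{-k} ≤ m^{-k} ((1 + 2ζ(k))^d - 1)` (`k > 1`, `m ≥ 1`).
[cite: Niederreiter1978, eq. (4.6)] -/
theorem sum_rWeight_rpow_inv_le_of_cRemV_eq_zero {k : ℝ} (hk : 1 < k) {m : ℕ} (hm : 0 < m)
    (t : Finset (d → ℤ)) (ht : ∀ h ∈ t, cRemV m h = 0) (ht0 : ∀ h ∈ t, h ≠ 0) :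
    ∑ h ∈ t, (rWeight h ^ k)⁻¹ ≤
      ((m : ℝ) ^ k)⁻¹ * ((1 + 2 * zetaReal k) ^ Fintype.card d - 1) := by
  classical
  have hk0 : 0 ≤ k := by linarith
  have hm' : (0 : ℝ) < m := by exact_mod_cast hm
  have hdec : ∀ h ∈ t, ∀ j, h j = m * cQuotV m h j := fun h hh j => by
    have e := cRemV_add_mul_cQuotV m h j
    rw [congr_fun (ht h hh) j, Pi.zero_apply, zero_add] at e
    exact e.symm
  have hq0 : ∀ h ∈ t, cQuotV m h ≠ 0 := fun h hh hq => ht0 h hh (funext fun j => by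
    simp [hdec h hh j, hq])
  have hle : ∀ h ∈ t, (rWeight h ^ k)⁻¹ ≤ ((m : ℝ) ^ k)⁻¹ * (rWeight (cQuotV m h) ^ k)⁻¹ :=
    fun h hh => by
    rw [← mul_inv, ← Real.mul_rpow hm'.le (rWeight_pos _).le]
    exact inv_anti₀ (Real.rpow_pos_of_pos (mul_pos hm' (rWeight_pos _)) k)
      (Real.rpow_le_rpow (mul_pos hm' (rWeight_pos _)).le
        (natCast_mul_rWeight_le hm (hq0 h hh) (hdec h hh)) hk0)
  have hinj : Set.InjOn (cQuotV m) (t : Set (d → ℤ)) := by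
    intro h hh h' hh' e
    funext j
    rw [hdec h hh j, hdec h' hh' j, e]
  have h0 : (0 : d → ℤ) ∉ t.image (cQuotV m) := by
    rw [Finset.mem_image]
    rintro ⟨h, hh, e⟩
    exact hq0 h hh e
  have hsum : ∑ q ∈ insert (0 : d → ℤ) (t.image (cQuotV m)), (rWeight q ^ k)⁻¹ ≤
      (1 + 2 * zetaReal k) ^ Fintype.card d := sum_rWeight_rpow_inv_le hk _
  rw [Finset.sum_insert h0, rWeight_zero, Real.one_rpow, inv_one] at hsum
  calc ∑ h ∈ t, (rWeight h ^ k)⁻¹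
      ≤ ∑ h ∈ t, ((m : ℝ) ^ k)⁻¹ * (rWeight (cQuotV m h) ^ k)⁻¹ := Finset.sum_le_sum hle
    _ = ((m : ℝ) ^ k)⁻¹ * ∑ q ∈ t.image (cQuotV m), (rWeight q ^ k)⁻¹ := by
        rw [Finset.mul_sum, Finset.sum_image hinj]
    _ ≤ ((m : ℝ) ^ k)⁻¹ * ((1 + 2 * zetaReal k) ^ Fintype.card d - 1) :=
        mul_le_mul_of_nonneg_left (by linarith) (by positivity)

/-- The finite form of (4.6): for every finite set `u` of nonzero points of the dual lattice,
`Σ_{𝐡 ∈ u} r(𝐡)^{-k} ≤ m^{-k} ((1 + 2ζ(k))^d - 1) + (1 + 2ζ(k))^d Σ_{0 ≠ 𝐡₀ ∈ C_d(m) ∩ L⊥}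
r(𝐡₀)^{-k}`
(grouping `u` along `𝐡 ↦ 𝐡₀ = cRemV m 𝐡 ∈ C_d(m) ∩ L⊥`). [cite: Niederreiter1978, eq. (4.6)] -/
theorem sum_rWeight_rpow_inv_le_of_subset_dualLattice {k : ℝ} (hk : 1 < k) {m : ℕ} (hm : 0 < m)
    (g : d → ℤ) (u : Finset (d → ℤ)) (hu : ∀ h ∈ u, h ≠ 0 ∧ h ∈ dualLattice m g) :
    ∑ h ∈ u, (rWeight h ^ k)⁻¹ ≤
      ((m : ℝ) ^ k)⁻¹ * ((1 + 2 * zetaReal k) ^ Fintype.card d - 1) +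
        (1 + 2 * zetaReal k) ^ Fintype.card d *
          ∑ h₀ ∈ (centeredBox d m).filter (fun h => h ≠ 0 ∧ h ∈ dualLattice m g),
            (rWeight h₀ ^ k)⁻¹ := by
  classical
  have hmaps : ∀ h ∈ u, cRemV m h ∈
      insert (0 : d → ℤ) ((centeredBox d m).filter (fun h => h ≠ 0 ∧ h ∈ dualLattice m g)) := by
    intro h hh
    rw [Finset.mem_insert]
    by_cases h0 : cRemV m h = 0
    · exact Or.inl h0
    · exact Or.inr (Finset.mem_filter.mpr
        ⟨cRemV_mem_centeredBox hm h, h0, cRemV_mem_dualLattice (hu h hh).2⟩)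
  have h0S : (0 : d → ℤ) ∉ (centeredBox d m).filter (fun h => h ≠ 0 ∧ h ∈ dualLattice m g) := by
    simp
  rw [← Finset.sum_fiberwise_of_maps_to hmaps, Finset.sum_insert h0S, Finset.mul_sum]
  refine add_le_add ?_ (Finset.sum_le_sum fun h₀ hh₀ => ?_)
  · exact sum_rWeight_rpow_inv_le_of_cRemV_eq_zero hk hm _
      (fun h hh => (Finset.mem_filter.mp hh).2) (fun h hh => (hu h (Finset.mem_filter.mp hh).1).1)
  · exact sum_rWeight_rpow_inv_le_of_cRemV_eq hk m (Finset.mem_filter.mp hh₀).1 _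
      (fun h hh => (Finset.mem_filter.mp hh).2)

/-- `P^{(k)}(g, m) ≤ m^{-k} ((1 + 2ζ(k))^d - 1) + (1 + 2ζ(k))^d Σ_{0 ≠ 𝐡₀ ∈ C_d(m) ∩ L⊥} r(𝐡₀)^{-k}`
for `k > 1`, `m ≥ 1` (the non-strict, slightly sharper form of (4.6) that the proof gives).
[cite: Niederreiter1978, eq. (4.6)] -/
theorem pFigure_le {k : ℝ} (hk : 1 < k) (g : d → ℤ) (m : ℕ) [NeZero m] :
    pFigure k g m ≤
      ((m : ℝ) ^ k)⁻¹ * ((1 + 2 * zetaReal k) ^ Fintype.card d - 1) +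
        (1 + 2 * zetaReal k) ^ Fintype.card d *
          ∑ h₀ ∈ (centeredBox d m).filter (fun h => h ≠ 0 ∧ h ∈ dualLattice m g),
            (rWeight h₀ ^ k)⁻¹ := by
  classical
  have hm : 0 < m := Nat.pos_of_ne_zero (NeZero.ne m)
  refine hasSum_le_of_sum_le (hasSum_pFigure hk g m) fun u => ?_
  have H := sum_rWeight_rpow_inv_le_of_subset_dualLattice hk hm g
    (u.map (Function.Embedding.subtype _)) fun h hh => by
      rw [Finset.mem_map] at hh
      obtain ⟨x, -, rfl⟩ := hh
      exact ⟨by simpa using x.2.2, by simpa using x.2.1⟩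
  simpa only [Finset.sum_map, Function.Embedding.coe_subtype] using H

/-- **Inequality (4.6)** [cite: Niederreiter1978, eq. (4.6)]: for any real `k > 1`, any lattice
point `g ∈ ℤᵈ` and any integer `m ≥ 2` (here: any `m ≠ 0`),
`P^{(k)}(g, m) < (1 + 2ζ(k))^d (m^{-k} + R(g, m)^k)`, where `R(g, m)` is the figure of merit
(Definition 4.3, `figureOfMerit`) and `ζ(k) = Σ_{n ≥ 1} n^{-k}` (cf. Niederreiter 1992,
Thm. 5.5). -/
theorem pFigure_lt {k : ℝ} (hk : 1 < k) (g : d → ℤ) (m : ℕ) [NeZero m] :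
    pFigure k g m <
      (1 + 2 * zetaReal k) ^ Fintype.card d * (((m : ℝ) ^ k)⁻¹ + figureOfMerit g m ^ k) := by
  classical
  have hm : 0 < m := Nat.pos_of_ne_zero (NeZero.ne m)
  have hm' : (0 : ℝ) < m := by exact_mod_cast hm
  have hK : 0 ≤ (1 + 2 * zetaReal k) ^ Fintype.card d :=
    pow_nonneg (by linarith [zetaReal_nonneg k]) _
  have hR : ∑ h₀ ∈ (centeredBox d m).filter (fun h => h ≠ 0 ∧ h ∈ dualLattice m g),
      (rWeight h₀ ^ k)⁻¹ ≤ figureOfMerit g m ^ k := by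
    rw [figureOfMerit]
    calc ∑ h₀ ∈ (centeredBox d m).filter (fun h => h ≠ 0 ∧ h ∈ dualLattice m g),
          (rWeight h₀ ^ k)⁻¹
        = ∑ h₀ ∈ (centeredBox d m).filter (fun h => h ≠ 0 ∧ h ∈ dualLattice m g),
            (rWeight h₀)⁻¹ ^ k :=
          Finset.sum_congr rfl fun h₀ _ => (Real.inv_rpow (rWeight_pos h₀).le k).symm
      _ ≤ _ := sum_rpow_le_rpow_sum _ (fun h => inv_nonneg.mpr (rWeight_pos h).le) hk.le
  have hmk : 0 < ((m : ℝ) ^ k)⁻¹ := inv_pos.mpr (Real.rpow_pos_of_pos hm' k)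
  calc pFigure k g m
      ≤ ((m : ℝ) ^ k)⁻¹ * ((1 + 2 * zetaReal k) ^ Fintype.card d - 1) +
          (1 + 2 * zetaReal k) ^ Fintype.card d *
            ∑ h₀ ∈ (centeredBox d m).filter (fun h => h ≠ 0 ∧ h ∈ dualLattice m g),
              (rWeight h₀ ^ k)⁻¹ := pFigure_le hk g m
    _ ≤ ((m : ℝ) ^ k)⁻¹ * ((1 + 2 * zetaReal k) ^ Fintype.card d - 1) +
          (1 + 2 * zetaReal k) ^ Fintype.card d * figureOfMerit g m ^ k :=
        add_le_add le_rfl (mul_le_mul_of_nonneg_left hR hK)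
    _ = (1 + 2 * zetaReal k) ^ Fintype.card d * (((m : ℝ) ^ k)⁻¹ + figureOfMerit g m ^ k) -
          ((m : ℝ) ^ k)⁻¹ := by ring
    _ < (1 + 2 * zetaReal k) ^ Fintype.card d * (((m : ℝ) ^ k)⁻¹ + figureOfMerit g m ^ k) :=
        sub_lt_self _ hmk

/-- **Theorem 4.2 combined with (4.6)** [cite: Niederreiter1978, eq. (4.6)]: for `f ∈ E^k(C)`,
`|Q_{m,g}(f) - ∫ f| ≤ C (1 + 2ζ(k))^d (m^{-k} + R(g, m)^k)`. -/
theorem norm_latticeRule_sub_integral_le_of_mem_korobovClass (m : ℕ) [NeZero m] (g : d → ℤ)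
    {k C : ℝ} (hk : 1 < k) {f : C(UnitAddTorus d, ℂ)} (hf : f ∈ KorobovClass d k C) (hC : 0 ≤ C) :
    ‖latticeRule m g f - ∫ x, f x‖ ≤
      C * ((1 + 2 * zetaReal k) ^ Fintype.card d * (((m : ℝ) ^ k)⁻¹ + figureOfMerit g m ^ k)) :=
  (norm_latticeRule_sub_integral_le_mul_pFigure m g hk hf).trans
    (mul_le_mul_of_nonneg_left (pFigure_lt hk g m).le hC)

/-! ### The error of the method of good lattice points for `f ∈ E^k(C)` (p. 986) -/

/-- **Error of the method of good lattice points on `E^k(C)`** [cite: Niederreiter1978, p. 986]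
(the remark "the integration error in (4.1) is of the order of magnitude `O(m^{-k} (log m)^{ks})`
for integrands `f ∈ E^k`", made explicit for prime moduli via Theorem 4.2, inequality (4.6) and the
existence of good lattice points of Korobov form, `exists_korobovPoint_figureOfMerit_lt` =
Niederreiter 1992, Thm. 5.18): for every dimension `s ≥ 2`, prime `N` and real `k > 1` there is an
integer `g ∈ {0, …, N-1}` such that the `N`-point lattice rule with lattice point
`(1, g, g², …, g^{s-1})` satisfies, for every `C` and every `f ∈ E^k_s(C)`,
`|Q_N(f) - ∫ f| ≤ C (1 + 2ζ(k))^s (N^{-k} + (((s-1)/N) (2 log N + 1)^s)^k)`. -/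
theorem exists_korobovPoint_norm_latticeRule_sub_integral_le {s N : ℕ} [NeZero N] (hs : 2 ≤ s)
    (hN : N.Prime) {k : ℝ} (hk : 1 < k) :
    ∃ g ∈ Finset.range N, ∀ (C : ℝ) (f : C(UnitAddTorus (Fin s), ℂ)),
      f ∈ KorobovClass (Fin s) k C →
        ‖latticeRule N (korobovPoint s ((g : ℕ) : ℤ)) f - ∫ x, f x‖ ≤
          C * ((1 + 2 * zetaReal k) ^ s *
            (((N : ℝ) ^ k)⁻¹ + (((s : ℝ) - 1) / N * (2 * Real.log N + 1) ^ s) ^ k)) := by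
  classical
  obtain ⟨g, hg, hR⟩ := exists_korobovPoint_figureOfMerit_lt hs hN
  refine ⟨g, hg, fun C f hf => ?_⟩
  haveI : Nonempty (Fin s) := ⟨⟨0, by omega⟩⟩
  have hC : 0 ≤ C := KorobovClass.nonneg hf
  have hk0 : 0 ≤ k := by linarith
  have hK : 0 ≤ (1 + 2 * zetaReal k) ^ s := pow_nonneg (by linarith [zetaReal_nonneg k]) _
  have hR0 : 0 ≤ figureOfMerit (korobovPoint s ((g : ℕ) : ℤ)) N :=
    Finset.sum_nonneg fun h _ => inv_nonneg.mpr (rWeight_pos h).le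
  have hRk : figureOfMerit (korobovPoint s ((g : ℕ) : ℤ)) N ^ k ≤
      (((s : ℝ) - 1) / N * (2 * Real.log N + 1) ^ s) ^ k :=
    Real.rpow_le_rpow hR0 hR.le hk0
  have H := norm_latticeRule_sub_integral_le_of_mem_korobovClass N (korobovPoint s ((g : ℕ) : ℤ))
    hk hf hC
  rw [Fintype.card_fin] at H
  refine H.trans (mul_le_mul_of_nonneg_left ?_ hC)
  exact mul_le_mul_of_nonneg_left (add_le_add le_rfl hRk) hK

end Literature.Analysis.Quadrature

end
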